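import Summits.RiemannHypothesis.RiemannHypothesis.Theorems.HandoffLatticeUncertainty
import HarnessLib

/-!
# THEOREM U0, part 2/4 — the pointwise bound on the lattice sum of the witness

Handoff track (ROUTE 1′), prove-1 gen14, ATTEMPT-21; continues `HandoffLatticeUncertainty` (part
1/4: objects, witness `F_η`, `dilationSum_F`, FACT Z). Here: the mean-value estimate
`‖t^w - s^w‖ ≤ ‖w‖(s/2)^{-1/2}(s-t)` (`norm_cpow_sub_cpow_le`), the MAIN-TERM bound
`‖u^{-ρ}N^{1-ρ}/(1-ρ) - c^{1-ρ}/(u(1-ρ))‖ ≤ (c/2)^{-1/2}` for `c-u ≤ uN ≤ c`, `uN ≥ c/2`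
(`norm_main_term_le`), the REMAINDER bound `‖u^{-ρ}(A(N) - N^{1-ρ}/(1-ρ))‖ ≤ C_K (c/2)^{-1/2}`
(`norm_remainder_le`, from FACT Z), `‖κ_η‖ ≤ 7`, the defining identity of `κ_η`, and LEMMA 1
(`norm_dilationSum_le`): for `0 < η ≤ 1/4`, `λ ≥ 1`, `0 < u ≤ 1`,
`‖θ_{F_η}(u)‖ ≤ K(1 + (η/2)^{-1/2})` if `u < η` and `≤ K + 2η^{1/2}/u` otherwise, `K = 30(1 + C_K)`
independent of `η` — the `u⁻¹` terms cancel because `ζ(ρ) = 0` and `∫ F_η = 0`. Parts 3/4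
(`…Aux`) and 4/4 (`…Degenerate`) integrate this. Nothing here bears on the truth of RH.
-/

set_option linter.dupNamespace false

noncomputable section

open Complex MeasureTheory Set Filter Finset
open scoped Real FourierTransform

namespace Summit.RiemannHypothesis.RiemannHypothesis.Theorems

namespace LatticeUncertainty


/-! ## The two analytic estimates: main terms and remainders after the factor `u^{-ρ}` -/

variable {ρ : ℂ}

/-- LEMMA Y: `‖t^w - s^w‖ ≤ ‖w‖ (s/2)^{-1/2} (s - t)` for `s/2 ≤ t ≤ s`, `Re w = 1/2` (mean value
inequality for `x ↦ x^w`, `‖w x^{w-1}‖ = ‖w‖ x^{-1/2}`). -/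
theorem norm_cpow_sub_cpow_le {w : ℂ} (hw : w.re = 1 / 2) {s t : ℝ} (hs : 0 < s)
    (hst : s / 2 ≤ t) (hts : t ≤ s) :
    ‖(t : ℂ) ^ w - (s : ℂ) ^ w‖ ≤ ‖w‖ * (s / 2) ^ (-(1 / 2 : ℝ)) * (s - t) := by
  have hw0 : w ≠ 0 := by intro h; rw [h] at hw; norm_num at hw
  set D : Set ℝ := Set.Icc (s / 2) s
  have hderiv : ∀ x ∈ D, HasDerivWithinAt (fun y : ℝ ↦ (y : ℂ) ^ w) (w * (x : ℂ) ^ (w - 1)) D x := by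
    intro x hx
    have hx0 : x ≠ 0 := (lt_of_lt_of_le (by positivity) hx.1).ne'
    exact (hasDerivAt_ofReal_cpow_const hx0 hw0).hasDerivWithinAt
  have hbound : ∀ x ∈ D, ‖w * (x : ℂ) ^ (w - 1)‖ ≤ ‖w‖ * (s / 2) ^ (-(1 / 2 : ℝ)) := by
    intro x hx
    have hx0 : 0 < x := lt_of_lt_of_le (by positivity) hx.1
    rw [norm_mul, Complex.norm_cpow_eq_rpow_re_of_pos hx0, sub_re, hw, one_re,
      show (1 / 2 : ℝ) - 1 = -(1 / 2) by norm_num]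
    have h1 : x ^ (-(1 / 2 : ℝ)) ≤ (s / 2) ^ (-(1 / 2 : ℝ)) :=
      Real.rpow_le_rpow_of_nonpos (by positivity) hx.1 (by norm_num)
    exact mul_le_mul_of_nonneg_left h1 (norm_nonneg _)
  have ht : t ∈ D := ⟨hst, hts⟩
  have hsD : s ∈ D := ⟨by linarith, le_rfl⟩
  have h := (convex_Icc (s / 2) s).norm_image_sub_le_of_norm_hasDerivWithin_le hderiv hbound hsD ht
  simp only [Real.norm_eq_abs] at h
  rw [abs_of_nonpos (by linarith)] at h
  calc ‖(t : ℂ) ^ w - (s : ℂ) ^ w‖ ≤ ‖w‖ * (s / 2) ^ (-(1 / 2 : ℝ)) * -(t - s) := h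
    _ = ‖w‖ * (s / 2) ^ (-(1 / 2 : ℝ)) * (s - t) := by ring

/-- `u^{-ρ} N^{1-ρ} = u⁻¹ (uN)^{1-ρ}` for `u > 0`. -/
theorem cpow_neg_mul_natCast_cpow {u : ℝ} (hu : 0 < u) (N : ℕ) :
    (u : ℂ) ^ (-ρ) * (N : ℂ) ^ (1 - ρ) = (u : ℂ)⁻¹ * (((u * N : ℝ)) : ℂ) ^ (1 - ρ) := by
  have hu0 : (u : ℂ) ≠ 0 := by exact_mod_cast hu.ne'
  rw [show ((u * N : ℝ) : ℂ) = (u : ℂ) * ((N : ℝ) : ℂ) by push_cast; ring,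
    Complex.mul_cpow_ofReal_nonneg hu.le (Nat.cast_nonneg N)]
  push_cast
  rw [← mul_assoc]
  congr 1
  rw [← Complex.cpow_neg_one, ← Complex.cpow_add _ _ hu0]
  congr 1; ring

/-- MAIN TERM: if `c - u ≤ uN ≤ c` and `c/2 ≤ uN` then
`‖u^{-ρ} N^{1-ρ}/(1-ρ) - c^{1-ρ}/(u(1-ρ))‖ ≤ (c/2)^{-1/2}`. -/
theorem norm_main_term_le (hre : ρ.re = 1 / 2) {c u : ℝ} (hc : 0 < c) (hu : 0 < u) {N : ℕ}
    (h1 : c - u ≤ u * N) (h2 : u * N ≤ c) (h3 : c / 2 ≤ u * N) :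
    ‖(u : ℂ) ^ (-ρ) * ((N : ℂ) ^ (1 - ρ) / (1 - ρ)) - (c : ℂ) ^ (1 - ρ) / ((u : ℂ) * (1 - ρ))‖
      ≤ (c / 2) ^ (-(1 / 2 : ℝ)) := by
  have hw : (1 - ρ).re = 1 / 2 := by rw [sub_re, one_re, hre]; norm_num
  have hw0 : 1 - ρ ≠ 0 := one_sub_ne_zero hre
  have hu0 : (u : ℂ) ≠ 0 := by exact_mod_cast hu.ne'
  have key : (u : ℂ) ^ (-ρ) * ((N : ℂ) ^ (1 - ρ) / (1 - ρ)) - (c : ℂ) ^ (1 - ρ) / ((u : ℂ) * (1 - ρ))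
      = ((u : ℂ)⁻¹ / (1 - ρ)) * ((((u * N : ℝ)) : ℂ) ^ (1 - ρ) - (c : ℂ) ^ (1 - ρ)) := by
    rw [mul_div_assoc', cpow_neg_mul_natCast_cpow hu N]
    field_simp
  rw [key, norm_mul, norm_div, norm_inv, Complex.norm_real, Real.norm_eq_abs, abs_of_pos hu]
  have hY := norm_cpow_sub_cpow_le hw hc h3 h2
  have hwpos : 0 < ‖1 - ρ‖ := norm_pos_iff.2 hw0
  calc u⁻¹ / ‖1 - ρ‖ * ‖(((u * N : ℝ)) : ℂ) ^ (1 - ρ) - (c : ℂ) ^ (1 - ρ)‖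
      ≤ u⁻¹ / ‖1 - ρ‖ * (‖1 - ρ‖ * (c / 2) ^ (-(1 / 2 : ℝ)) * (c - u * N)) := by
        gcongr
    _ = (c / 2) ^ (-(1 / 2 : ℝ)) * ((c - u * N) / u) := by field_simp
    _ ≤ (c / 2) ^ (-(1 / 2 : ℝ)) * 1 := by
        have hle : (c - u * N) / u ≤ 1 := by rw [div_le_one hu]; linarith
        exact mul_le_mul_of_nonneg_left hle (by positivity)
    _ = (c / 2) ^ (-(1 / 2 : ℝ)) := mul_one _

/-- REMAINDER TERM: if `c/2 ≤ uN` then `‖u^{-ρ} (A(N) - N^{1-ρ}/(1-ρ))‖ ≤ C_K (c/2)^{-1/2}`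
(FACT Z when `|γ| ≤ 4N`, the trivial bound below the threshold). -/
theorem norm_remainder_le (h0 : riemannZeta ρ = 0) (hre : ρ.re = 1 / 2) (him : ρ.im ≠ 0)
    {c u : ℝ} (hc : 0 < c) (hu : 0 < u) {N : ℕ} (h3 : c / 2 ≤ u * N) :
    ‖(u : ℂ) ^ (-ρ) * (A ρ N - (N : ℂ) ^ (1 - ρ) / (1 - ρ))‖ ≤ CK ρ * (c / 2) ^ (-(1 / 2 : ℝ)) := by
  have hN : 1 ≤ N := by
    rcases Nat.eq_zero_or_pos N with rfl | h
    · simp at h3; linarith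
    · exact h
  have hNpos : (0 : ℝ) < N := by exact_mod_cast hN
  have hq : 0 < (c / 2) ^ (-(1 / 2 : ℝ)) := by positivity
  rw [norm_mul, Complex.norm_cpow_eq_rpow_re_of_pos hu, neg_re, hre]
  have hCK : (6 : ℝ) ≤ CK ρ := by unfold CK; nlinarith [sq_nonneg ((Nγ ρ : ℝ) + 1)]
  by_cases hγ : |ρ.im| ≤ 4 * N
  · -- FACT Z: `u^{-1/2} · 6 N^{-1/2} = 6 (uN)^{-1/2} ≤ 6 (c/2)^{-1/2}`
    have hZ := norm_A_sub_main_le h0 hre him hN hγ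
    calc u ^ (-(1 / 2 : ℝ)) * ‖A ρ N - (N : ℂ) ^ (1 - ρ) / (1 - ρ)‖
        ≤ u ^ (-(1 / 2 : ℝ)) * (6 * (N : ℝ) ^ (-(1 / 2 : ℝ))) := by gcongr
      _ = 6 * (u * N) ^ (-(1 / 2 : ℝ)) := by
          rw [Real.mul_rpow hu.le hNpos.le]; ring
      _ ≤ 6 * (c / 2) ^ (-(1 / 2 : ℝ)) := by
          have hle : (u * N) ^ (-(1 / 2 : ℝ)) ≤ (c / 2) ^ (-(1 / 2 : ℝ)) :=
            Real.rpow_le_rpow_of_nonpos (by positivity) h3 (by norm_num)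
          linarith
      _ ≤ CK ρ * (c / 2) ^ (-(1 / 2 : ℝ)) := by gcongr
  · -- below the threshold: `N + 1 ≤ N_γ`, `u ≥ c/(2N)`
    rw [not_le] at hγ
    have hNγ : (N : ℝ) ≤ Nγ ρ := by
      have : (N : ℝ) ≤ |ρ.im| / 4 := by linarith
      exact this.trans (Nat.le_ceil _)
    have hE := norm_A_sub_main_le_const h0 hre him N
    have hu' : c / 2 / N ≤ u := by rw [div_le_iff₀ hNpos]; linarith
    have hupow : u ^ (-(1 / 2 : ℝ)) ≤ (c / 2 / N) ^ (-(1 / 2 : ℝ)) :=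
      Real.rpow_le_rpow_of_nonpos (by positivity) hu' (by norm_num)
    have hsplit : (c / 2 / N) ^ (-(1 / 2 : ℝ)) = (c / 2) ^ (-(1 / 2 : ℝ)) * (N : ℝ) ^ (1 / 2 : ℝ) := by
      rw [Real.div_rpow (by positivity) hNpos.le, Real.rpow_neg hNpos.le, div_inv_eq_mul]
    have hNhalf : (N : ℝ) ^ (1 / 2 : ℝ) ≤ N := by
      have h := Real.rpow_le_rpow_of_exponent_le (x := (N : ℝ)) (by exact_mod_cast hN)
        (show (1 / 2 : ℝ) ≤ 1 by norm_num)
      rwa [Real.rpow_one] at h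
    calc u ^ (-(1 / 2 : ℝ)) * ‖A ρ N - (N : ℂ) ^ (1 - ρ) / (1 - ρ)‖
        ≤ ((c / 2) ^ (-(1 / 2 : ℝ)) * N) * (3 * (Nγ ρ : ℝ) + 6) := by
          gcongr
          exact hupow.trans (by rw [hsplit]; gcongr)
      _ ≤ (c / 2) ^ (-(1 / 2 : ℝ)) * ((Nγ ρ : ℝ) * (3 * Nγ ρ + 6)) := by
          rw [mul_assoc]; gcongr
      _ ≤ CK ρ * (c / 2) ^ (-(1 / 2 : ℝ)) := by
          rw [mul_comm]
          gcongr
          unfold CK; nlinarith [Nat.cast_nonneg (α := ℝ) (Nγ ρ)]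

/-- `‖κ_η‖ ≤ 7` for `0 < η ≤ 1` (`|1 - η^w| ≤ 2`, `|1 - (1/2)^w| ≥ 1 - 2^{-1/2}`). -/
theorem norm_kappa_le (hre : ρ.re = 1 / 2) {η : ℝ} (hη : 0 < η) (hη1 : η ≤ 1) :
    ‖kappa ρ η‖ ≤ 7 := by
  have hw : (1 - ρ).re = 1 / 2 := by rw [sub_re, one_re, hre]; norm_num
  unfold kappa
  rw [norm_div]
  have hnum : ‖1 - (η : ℂ) ^ (1 - ρ)‖ ≤ 2 := by
    calc ‖1 - (η : ℂ) ^ (1 - ρ)‖ ≤ ‖(1 : ℂ)‖ + ‖(η : ℂ) ^ (1 - ρ)‖ := norm_sub_le _ _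
      _ ≤ 1 + 1 := by
          rw [norm_one, Complex.norm_cpow_eq_rpow_re_of_pos hη, hw]
          gcongr
          exact Real.rpow_le_one hη.le hη1 (by norm_num)
      _ = 2 := by norm_num
  have hden : 1 - (2 : ℝ) ^ (-(1 / 2 : ℝ)) ≤ ‖1 - (((1 / 2 : ℝ)) : ℂ) ^ (1 - ρ)‖ := by
    calc 1 - (2 : ℝ) ^ (-(1 / 2 : ℝ)) = ‖(1 : ℂ)‖ - ‖(((1 / 2 : ℝ)) : ℂ) ^ (1 - ρ)‖ := by
          rw [norm_one, Complex.norm_cpow_eq_rpow_re_of_pos (by norm_num), hw,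
            show (1 / 2 : ℝ) = (2 : ℝ)⁻¹ by norm_num, Real.inv_rpow (by norm_num),
            Real.rpow_neg (by norm_num)]
      _ ≤ ‖1 - (((1 / 2 : ℝ)) : ℂ) ^ (1 - ρ)‖ := norm_sub_norm_le _ _
  have h2 : (2 : ℝ) ^ (-(1 / 2 : ℝ)) ≤ 5 / 7 := by
    -- `2^{-1/2} = 1/√2 < 0.7072`
    have : (2 : ℝ) ^ (-(1 / 2 : ℝ)) = (Real.sqrt 2)⁻¹ := by
      rw [Real.sqrt_eq_rpow, ← Real.rpow_neg (by norm_num)]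
    rw [this, inv_le_comm₀ (by positivity) (by norm_num)]
    have h14 : (7 / 5 : ℝ) ≤ Real.sqrt 2 := by
      rw [Real.le_sqrt (by norm_num) (by norm_num)]; norm_num
    linarith
  have hden' : (2 / 7 : ℝ) ≤ ‖1 - (((1 / 2 : ℝ)) : ℂ) ^ (1 - ρ)‖ := by linarith
  calc ‖1 - (η : ℂ) ^ (1 - ρ)‖ / ‖1 - (((1 / 2 : ℝ)) : ℂ) ^ (1 - ρ)‖
      ≤ 2 / (2 / 7) := by
        gcongr
    _ = 7 := by norm_num

/-- The defining identity of `κ_η`: `(1 - κ_η) + κ_η (1/2)^{1-ρ} = η^{1-ρ}`. -/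
theorem kappa_identity (hre : ρ.re = 1 / 2) (η : ℝ) :
    (1 - kappa ρ η) + kappa ρ η * (((1 / 2 : ℝ)) : ℂ) ^ (1 - ρ) = (η : ℂ) ^ (1 - ρ) := by
  have hw : (1 - ρ).re = 1 / 2 := by rw [sub_re, one_re, hre]; norm_num
  have hden : (1 : ℂ) - (((1 / 2 : ℝ)) : ℂ) ^ (1 - ρ) ≠ 0 := by
    intro h
    have : ‖(((1 / 2 : ℝ)) : ℂ) ^ (1 - ρ)‖ = 1 := by rw [← sub_eq_zero.1 h]; simp
    rw [Complex.norm_cpow_eq_rpow_re_of_pos (by norm_num), hw] at this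
    have : (1 / 2 : ℝ) ^ (1 / 2 : ℝ) < 1 := Real.rpow_lt_one (by norm_num) (by norm_num) (by norm_num)
    linarith
  unfold kappa
  field_simp
  ring


/-! ## The pointwise bound on the lattice sum of the witness -/

variable {ρ : ℂ}

/-- Floor bookkeeping for `N₁ = ⌊1/u⌋`, `0 < u ≤ 1`: `1 - u ≤ uN₁ ≤ 1` and `uN₁ ≥ 1/2`. -/
theorem floor_bounds {u : ℝ} (hu : 0 < u) (hu1 : u ≤ 1) :
    1 - u ≤ u * ⌊1 / u⌋₊ ∧ u * ⌊1 / u⌋₊ ≤ (1 : ℝ) ∧ 1 / 2 ≤ u * ⌊1 / u⌋₊ := by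
  have hx : 0 ≤ 1 / u := by positivity
  have hfl : (⌊1 / u⌋₊ : ℝ) ≤ 1 / u := Nat.floor_le hx
  have hfl' : 1 / u < (⌊1 / u⌋₊ : ℝ) + 1 := Nat.lt_floor_add_one _
  have h1 : 1 - u ≤ u * ⌊1 / u⌋₊ := by
    have : u * (1 / u) = 1 := by field_simp
    nlinarith
  have h2 : u * ⌊1 / u⌋₊ ≤ (1 : ℝ) := by
    calc u * ⌊1 / u⌋₊ ≤ u * (1 / u) := by gcongr
      _ = 1 := by field_simp
  refine ⟨h1, h2, ?_⟩
  by_cases hu2 : u ≤ 1 / 2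
  · linarith
  · have hN : (1 : ℝ) ≤ ⌊1 / u⌋₊ := by
      have : 1 ≤ ⌊1 / u⌋₊ := Nat.one_le_floor_iff _ |>.2 (by rw [le_div_iff₀ hu]; linarith)
      exact_mod_cast this
    nlinarith

/-- Ceiling bookkeeping for `N_c = ⌈c/u⌉ - 1`, `0 < u < c`: `c - u ≤ uN_c ≤ c` and `uN_c ≥ c/2`. -/
theorem ceil_bounds {c u : ℝ} (hc : 0 < c) (hu : 0 < u) (huc : u < c) :
    c - u ≤ u * ((⌈c / u⌉₊ - 1 : ℕ) : ℝ) ∧ u * ((⌈c / u⌉₊ - 1 : ℕ) : ℝ) ≤ c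
      ∧ c / 2 ≤ u * ((⌈c / u⌉₊ - 1 : ℕ) : ℝ) := by
  have hx : 1 < c / u := by rw [lt_div_iff₀ hu]; linarith
  have hx0 : 0 ≤ c / u := by positivity
  have hc2 : 2 ≤ ⌈c / u⌉₊ := Nat.lt_ceil.2 (by exact_mod_cast hx)
  have hcast : ((⌈c / u⌉₊ - 1 : ℕ) : ℝ) = (⌈c / u⌉₊ : ℝ) - 1 := by
    rw [Nat.cast_sub (by omega), Nat.cast_one]
  rw [hcast]
  have hce : c / u ≤ (⌈c / u⌉₊ : ℝ) := Nat.le_ceil _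
  have hce' : (⌈c / u⌉₊ : ℝ) < c / u + 1 := Nat.ceil_lt_add_one hx0
  have hcu : u * (c / u) = c := by field_simp
  have h1 : c - u ≤ u * ((⌈c / u⌉₊ : ℝ) - 1) := by nlinarith
  have h2 : u * ((⌈c / u⌉₊ : ℝ) - 1) ≤ c := by nlinarith
  refine ⟨h1, h2, ?_⟩
  by_cases hu2 : u ≤ c / 2
  · linarith
  · have hN : (1 : ℝ) ≤ (⌈c / u⌉₊ : ℝ) - 1 := by
      have h2 : (2 : ℝ) ≤ (⌈c / u⌉₊ : ℝ) := by exact_mod_cast hc2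
      linarith
    nlinarith

/-- For `c ≤ u`, `⌈c/u⌉ - 1 = 0`. -/
theorem ceil_sub_one_eq_zero {c u : ℝ} (hu : 0 < u) (hcu : c ≤ u) : ⌈c / u⌉₊ - 1 = 0 := by
  have : ⌈c / u⌉₊ ≤ 1 := Nat.ceil_le.2 (by rw [Nat.cast_one, div_le_one hu]; exact hcu)
  omega

/-- `(1/2)^{-1/2} ≤ 2` and `(1/4)^{-1/2} ≤ 2`: any `a ≥ 1/4` has `a^{-1/2} ≤ 2`. -/
theorem rpow_neg_half_le_two {a : ℝ} (ha : 1 / 4 ≤ a) : a ^ (-(1 / 2 : ℝ)) ≤ 2 := by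
  have h : a ^ (-(1 / 2 : ℝ)) ≤ (1 / 4 : ℝ) ^ (-(1 / 2 : ℝ)) :=
    Real.rpow_le_rpow_of_nonpos (by norm_num) ha (by norm_num)
  have h4 : (1 / 4 : ℝ) ^ (-(1 / 2 : ℝ)) = 2 := by
    rw [show (1 / 4 : ℝ) = (2 : ℝ) ^ (-(2 : ℝ)) by
      rw [Real.rpow_neg (by norm_num), Real.rpow_two]; norm_num,
      ← Real.rpow_mul (by norm_num)]
    norm_num
  linarith

/-- `K = 30 (1 + C_K)`: the η-independent constant of the pointwise bound. -/
def K (ρ : ℂ) : ℝ := 30 * (1 + CK ρ)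

/-- `K > 0`. -/
theorem K_pos : 0 < K ρ := by unfold K; have := CK_pos (ρ := ρ); positivity

set_option maxHeartbeats 400000 in
/-- **LEMMA 1 (pointwise).** For `0 < η ≤ 1/4`, `λ ≥ 1`, `0 < u ≤ 1`:
`‖θ_{F_η}(u)‖ ≤ K (1 + (η/2)^{-1/2})` if `u < η`, and `≤ K + 2 η^{1/2}/u` if `u ≥ η`. -/
theorem norm_dilationSum_le (h0 : riemannZeta ρ = 0) (hre : ρ.re = 1 / 2) (him : ρ.im ≠ 0)
    {η lam u : ℝ} (hη : 0 < η) (hη4 : η ≤ 1 / 4) (hlam : 1 ≤ lam) (hu : 0 < u) (hu1 : u ≤ 1) :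
    ‖dilationSum lam (F ρ η) u‖
      ≤ if u < η then K ρ * (1 + (η / 2) ^ (-(1 / 2 : ℝ))) else K ρ + 2 * η ^ (1 / 2 : ℝ) / u := by
  have hw : (1 - ρ).re = 1 / 2 := by rw [sub_re, one_re, hre]; norm_num
  have hw0 : 1 - ρ ≠ 0 := one_sub_ne_zero hre
  have hu0 : (u : ℂ) ≠ 0 := by exact_mod_cast hu.ne'
  have hCK := CK_pos (ρ := ρ)
  have hK : K ρ = 30 * (1 + CK ρ) := rfl
  have hκ : ‖kappa ρ η‖ ≤ 7 := norm_kappa_le hre hη (by linarith)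
  have h1κ : ‖1 - kappa ρ η‖ ≤ 8 := by
    calc ‖1 - kappa ρ η‖ ≤ ‖(1 : ℂ)‖ + ‖kappa ρ η‖ := norm_sub_le _ _
      _ ≤ 1 + 7 := by rw [norm_one]; gcongr
      _ = 8 := by norm_num
  rw [dilationSum_F hη (by linarith) hlam hu]
  set κ := kappa ρ η with hκdef
  set N₁ := ⌊1 / u⌋₊ with hN₁
  set N₀ := ⌈η / u⌉₊ - 1 with hN₀
  set Nh := ⌈(1 / 2) / u⌉₊ - 1 with hNh
  -- the pieces
  set M : ℕ → ℂ := fun N ↦ (N : ℂ) ^ (1 - ρ) / (1 - ρ) with hM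
  have hA : ∀ N, A ρ N = M N + (A ρ N - M N) := fun N ↦ by ring
  obtain ⟨hf1, hf2, hf3⟩ := floor_bounds hu hu1
  have hupow : ‖(u : ℂ) ^ (-ρ)‖ = u ^ (-(1 / 2 : ℝ)) := by
    rw [Complex.norm_cpow_eq_rpow_re_of_pos hu, neg_re, hre]
  by_cases hu2 : 1 / 2 ≤ u
  · -- regime `[1/2, 1]`: `N₀ = N_h = 0`, `θ = u^{-ρ} (1-κ) A(N₁)`, `N₁ ≤ 2`
    have hN0' : N₀ = 0 := ceil_sub_one_eq_zero hu (by linarith)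
    have hNh' : Nh = 0 := ceil_sub_one_eq_zero hu hu2
    have hA0 : A ρ 0 = 0 := by simp [A]
    simp only [hN0', hNh', hA0, sub_zero]
    have hN₁2 : (N₁ : ℝ) ≤ 2 := by
      calc (N₁ : ℝ) ≤ 1 / u := Nat.floor_le (by positivity)
        _ ≤ 2 := by rw [div_le_iff₀ hu]; linarith
    have hθ : ‖(u : ℂ) ^ (-ρ) * (A ρ N₁ - κ * A ρ N₁)‖ ≤ 2 * (8 * 2) := by
      rw [show A ρ N₁ - κ * A ρ N₁ = (1 - κ) * A ρ N₁ by ring, norm_mul, norm_mul, hupow]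
      have hu12 : u ^ (-(1 / 2 : ℝ)) ≤ 2 := rpow_neg_half_le_two (by linarith)
      have hA1 : ‖A ρ N₁‖ ≤ 2 := (norm_A_le hre N₁).trans hN₁2
      have : ‖1 - κ‖ * ‖A ρ N₁‖ ≤ 8 * 2 :=
        mul_le_mul h1κ hA1 (norm_nonneg _) (by norm_num)
      exact mul_le_mul hu12 this (by positivity) (by norm_num)
    have hnot : ¬ u < η := by linarith
    rw [if_neg hnot]
    have : (0 : ℝ) ≤ 2 * η ^ (1 / 2 : ℝ) / u := by positivity
    have hCK6 : (6 : ℝ) ≤ CK ρ := by unfold CK; nlinarith [sq_nonneg ((Nγ ρ : ℝ) + 1)]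
    nlinarith
  · -- regime `(0, 1/2)`
    rw [not_le] at hu2
    obtain ⟨hh1, hh2, hh3⟩ := ceil_bounds (c := 1 / 2) (by norm_num) hu hu2
    -- main and remainder bounds at `N₁` (c = 1) and `N_h` (c = 1/2)
    have T1 := norm_main_term_le hre (c := 1) one_pos hu (N := N₁) hf1 hf2 (by linarith)
    have R1 := norm_remainder_le h0 hre him (c := 1) one_pos hu (N := N₁) (by linarith)
    have Th := norm_main_term_le hre (c := 1 / 2) (by norm_num) hu (N := Nh) hh1 hh2 hh3
    have Rh := norm_remainder_le h0 hre him (c := 1 / 2) (by norm_num) hu (N := Nh) hh3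
    have hq1 : (1 / 2 : ℝ) ^ (-(1 / 2 : ℝ)) ≤ 2 := by
      simpa using rpow_neg_half_le_two (a := 1 / 2) (by norm_num)
    have hq2 : (1 / 2 / 2 : ℝ) ^ (-(1 / 2 : ℝ)) ≤ 2 := rpow_neg_half_le_two (by norm_num)
    rw [show ((1 : ℝ) : ℂ) ^ (1 - ρ) = 1 by simp] at T1
    have hkid := kappa_identity hre η
    rw [← hκdef] at hkid
    -- abbreviations
    set t1 := (u : ℂ) ^ (-ρ) * M N₁ - 1 / ((u : ℂ) * (1 - ρ)) with ht1
    set r1 := (u : ℂ) ^ (-ρ) * (A ρ N₁ - M N₁) with hr1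
    set th := (u : ℂ) ^ (-ρ) * M Nh - (((1 / 2 : ℝ)) : ℂ) ^ (1 - ρ) / ((u : ℂ) * (1 - ρ)) with hth
    set rh := (u : ℂ) ^ (-ρ) * (A ρ Nh - M Nh) with hrh
    have nt1 : ‖t1‖ ≤ 2 := T1.trans hq1
    have nr1 : ‖r1‖ ≤ CK ρ * 2 := R1.trans (by gcongr)
    have nth : ‖th‖ ≤ 2 := Th.trans hq2
    have nrh : ‖rh‖ ≤ CK ρ * 2 := Rh.trans (by gcongr)
    have hsum : ‖(1 - κ) * (t1 + r1) + κ * (th + rh)‖ ≤ 30 * (1 + CK ρ) := by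
      calc ‖(1 - κ) * (t1 + r1) + κ * (th + rh)‖
          ≤ ‖1 - κ‖ * (‖t1‖ + ‖r1‖) + ‖κ‖ * (‖th‖ + ‖rh‖) := by
            calc _ ≤ ‖(1 - κ) * (t1 + r1)‖ + ‖κ * (th + rh)‖ := norm_add_le _ _
              _ ≤ _ := by
                rw [norm_mul, norm_mul]
                gcongr <;> exact norm_add_le _ _
        _ ≤ 8 * (2 + CK ρ * 2) + 7 * (2 + CK ρ * 2) := by
            gcongr
        _ = 30 * (1 + CK ρ) := by ring
    by_cases huη : u < η
    · -- regime `(0, η)`: the `η^{1-ρ}/(u(1-ρ))` terms cancel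
      obtain ⟨he1, he2, he3⟩ := ceil_bounds hη hu huη
      have T0 := norm_main_term_le hre hη hu (N := N₀) he1 he2 he3
      have R0 := norm_remainder_le h0 hre him hη hu (N := N₀) he3
      set t0 := (u : ℂ) ^ (-ρ) * M N₀ - (η : ℂ) ^ (1 - ρ) / ((u : ℂ) * (1 - ρ)) with ht0
      set r0 := (u : ℂ) ^ (-ρ) * (A ρ N₀ - M N₀) with hr0
      have hid : (u : ℂ) ^ (-ρ) * ((A ρ N₁ - A ρ N₀) - κ * (A ρ N₁ - A ρ Nh))
          = (1 - κ) * (t1 + r1) + κ * (th + rh) - (t0 + r0) := by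
        rw [ht1, hr1, hth, hrh, ht0, hr0]
        linear_combination (1 / ((u : ℂ) * (1 - ρ))) * hkid
      rw [hid, if_pos huη]
      calc ‖(1 - κ) * (t1 + r1) + κ * (th + rh) - (t0 + r0)‖
          ≤ ‖(1 - κ) * (t1 + r1) + κ * (th + rh)‖ + ‖t0 + r0‖ := norm_sub_le _ _
        _ ≤ 30 * (1 + CK ρ) + (1 + CK ρ) * (η / 2) ^ (-(1 / 2 : ℝ)) := by
            gcongr
            calc ‖t0 + r0‖ ≤ ‖t0‖ + ‖r0‖ := norm_add_le _ _
              _ ≤ (η / 2) ^ (-(1 / 2 : ℝ)) + CK ρ * (η / 2) ^ (-(1 / 2 : ℝ)) := add_le_add T0 R0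
              _ = (1 + CK ρ) * (η / 2) ^ (-(1 / 2 : ℝ)) := by ring
        _ ≤ K ρ * (1 + (η / 2) ^ (-(1 / 2 : ℝ))) := by
            rw [hK]
            have : 0 ≤ (η / 2) ^ (-(1 / 2 : ℝ)) := by positivity
            nlinarith
    · -- regime `[η, 1/2)`: `N₀ = 0`, the surviving term is `η^{1-ρ}/(u(1-ρ))`
      rw [not_lt] at huη
      have hN0' : N₀ = 0 := ceil_sub_one_eq_zero hu huη
      have hA0 : A ρ N₀ = 0 := by rw [hN0']; simp [A]
      have hid : (u : ℂ) ^ (-ρ) * ((A ρ N₁ - A ρ N₀) - κ * (A ρ N₁ - A ρ Nh))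
          = (1 - κ) * (t1 + r1) + κ * (th + rh) + (η : ℂ) ^ (1 - ρ) / ((u : ℂ) * (1 - ρ)) := by
        rw [hA0, ht1, hr1, hth, hrh]
        linear_combination (1 / ((u : ℂ) * (1 - ρ))) * hkid
      rw [hid, if_neg (not_lt.2 huη)]
      have hlast : ‖(η : ℂ) ^ (1 - ρ) / ((u : ℂ) * (1 - ρ))‖ ≤ 2 * η ^ (1 / 2 : ℝ) / u := by
        rw [norm_div, norm_mul, Complex.norm_cpow_eq_rpow_re_of_pos hη, hw, Complex.norm_real,
          Real.norm_eq_abs, abs_of_pos hu, div_le_div_iff₀ (by positivity) hu]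
        have h12 := norm_one_sub_ge hre
        have hη' : 0 ≤ η ^ (1 / 2 : ℝ) := by positivity
        have key : 0 ≤ η ^ (1 / 2 : ℝ) * u * (2 * ‖1 - ρ‖ - 1) :=
          mul_nonneg (mul_nonneg hη' hu.le) (by linarith)
        nlinarith [key]
      calc ‖(1 - κ) * (t1 + r1) + κ * (th + rh) + (η : ℂ) ^ (1 - ρ) / ((u : ℂ) * (1 - ρ))‖
          ≤ ‖(1 - κ) * (t1 + r1) + κ * (th + rh)‖ + ‖(η : ℂ) ^ (1 - ρ) / ((u : ℂ) * (1 - ρ))‖ :=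
            norm_add_le _ _
        _ ≤ 30 * (1 + CK ρ) + 2 * η ^ (1 / 2 : ℝ) / u := add_le_add hsum hlast
        _ = K ρ + 2 * η ^ (1 / 2 : ℝ) / u := by rw [hK]

end LatticeUncertainty

end Summit.RiemannHypothesis.RiemannHypothesis.Theorems
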